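import Mathlib
import Literature.MathematicalPhysics.QuantumLattice.WilsonDiracAP
import Summits.QuantumFields.QCD.Theorems.QuarksAsStableActionDefs
import Summits.QuantumFields.QCD.Theorems.QuarksAsStableActionUnquenchedChessboardBoundStubMarginalRPChiral
import HarnessLib

/-!
# Link Gram identity, part 1: the diluted operator in the chiral spin basis and its time mirror
(crux stmt-QuantumFields-9735, line `Sketch`, lead's stub `linkGram`)

* `spinorLift_mul_bondWilsonDiracG`, `det_bondWilsonDiracG_chiral` — a change of spin basis is a
  conjugation of the bond-diluted Wilson–Dirac matrix, so `det D_E` may be computed with the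
  `γ₀`-diagonal matrices `chiralGamma`;
* `chiral_eps_table_plus/minus` — the spin tables `Γ₀ (r ± γ'_μ)ᴴᵀ Γ₀` (`Γ₀ = γ'₀ = diag(1,1,-1,-1)`);
* `bondWilsonDiracG_chiral_timeReflect` — **the time mirror**: for a time reflection `θ` of the
  sites (`θ(x + ê₀) = θx - ê₀`, e.g. the tree's link reflection `t ↦ 1 - t`), the reflected field
  `V` (`V(x,0) = U(θ(x+ê₀),0)⁻¹`, `V(x,k) = U(θx,k)`) and the reflected bond set `E'`,
  `D'_{E'}[V]_{p,q} = ε_{α_p} ε_{α_q} · conj D'_E[U]_{θ̂q, θ̂p}` with `ε = diag γ'₀` and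
  `θ̂ (x,a,α) = (θx,a,α)`: the lower block of a reflection-symmetric diluted operator is
  `Γ₀ (upper block of the mirrored field)ᴴ Γ₀`.

All statements are proved.
-/

noncomputable section

open Matrix Complex Finset
open Literature.MathematicalPhysics.QuantumFieldTheory Literature.MathematicalPhysics.QuantumLattice
open Literature.Probability.LatticeModels
open Summit.QuantumFields.QCD.Theorems.QuarksAsStableAction
open scoped ComplexConjugate BigOperators

namespace Summit.QuantumFields.QCD.Theorems.UnquenchedChessboardBoundLine

variable {L N : ℕ} {G : Type*} [Group G] (ρ : G →* Matrix (Fin N) (Fin N) ℂ)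

/-! ## Change of spin basis -/

/-- The spin-matrix part of an entry of `bondWilsonDiracG` conjugated by `u`: if `u γ_μ = γ'_μ u`
then `Σ_α u_{σα} K^γ_{αβ'}… `; stated as the `4 × 4` kernel identity `u K^γ = K^{γ'} u` between two
site–colour pairs. -/
theorem bondKernel_conj {γ γ' : Fin 4 → Matrix (Fin 4) (Fin 4) ℂ} {u : Matrix (Fin 4) (Fin 4) ℂ}
    (hγ : ∀ μ, u * γ μ = γ' μ * u) (E : Finset (Edge 4 L)) (U : GaugeConfig 4 L G) (m r : ℝ)
    (x : TorusSite 4 L) (a : Fin N) (y : TorusSite 4 L) (b : Fin N) :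
    u * ((if x = y ∧ a = b then ((m + 4 * r : ℝ) : ℂ) else 0) • (1 : Matrix (Fin 4) (Fin 4) ℂ) -
        (1 / 2 : ℂ) • ∑ μ : Fin 4,
          ((if y = Site.shift x μ ∧ (x, μ) ∈ E then ρ (U (x, μ)) a b else 0) •
              ((r : ℂ) • (1 : Matrix (Fin 4) (Fin 4) ℂ) - γ μ) +
            (if x = Site.shift y μ ∧ (y, μ) ∈ E then ρ (U (y, μ))⁻¹ a b else 0) •
              ((r : ℂ) • (1 : Matrix (Fin 4) (Fin 4) ℂ) + γ μ))) =
      ((if x = y ∧ a = b then ((m + 4 * r : ℝ) : ℂ) else 0) • (1 : Matrix (Fin 4) (Fin 4) ℂ) -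
        (1 / 2 : ℂ) • ∑ μ : Fin 4,
          ((if y = Site.shift x μ ∧ (x, μ) ∈ E then ρ (U (x, μ)) a b else 0) •
              ((r : ℂ) • (1 : Matrix (Fin 4) (Fin 4) ℂ) - γ' μ) +
            (if x = Site.shift y μ ∧ (y, μ) ∈ E then ρ (U (y, μ))⁻¹ a b else 0) •
              ((r : ℂ) • (1 : Matrix (Fin 4) (Fin 4) ℂ) + γ' μ))) * u := by
  simp only [Matrix.mul_sub, Matrix.sub_mul, Matrix.mul_smul, Matrix.smul_mul, Matrix.mul_one,
    Matrix.one_mul, Matrix.mul_sum, Matrix.sum_mul, Matrix.mul_add, Matrix.add_mul, hγ]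

/-- Entries of `bondWilsonDiracG` through the `4 × 4` kernel. -/
theorem bondWilsonDiracG_apply_kernel (γ : Fin 4 → Matrix (Fin 4) (Fin 4) ℂ) (E : Finset (Edge 4 L))
    (U : GaugeConfig 4 L G) (m r : ℝ) (p q : TorusSite 4 L × Fin N × Fin 4) :
    bondWilsonDiracG ρ γ E U m r p q =
      ((if p.1 = q.1 ∧ p.2.1 = q.2.1 then ((m + 4 * r : ℝ) : ℂ) else 0) •
            (1 : Matrix (Fin 4) (Fin 4) ℂ) -
        (1 / 2 : ℂ) • ∑ μ : Fin 4,
          ((if q.1 = Site.shift p.1 μ ∧ (p.1, μ) ∈ E then ρ (U (p.1, μ)) p.2.1 q.2.1 else 0) •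
              ((r : ℂ) • (1 : Matrix (Fin 4) (Fin 4) ℂ) - γ μ) +
            (if p.1 = Site.shift q.1 μ ∧ (q.1, μ) ∈ E then ρ (U (q.1, μ))⁻¹ p.2.1 q.2.1 else 0) •
              ((r : ℂ) • (1 : Matrix (Fin 4) (Fin 4) ℂ) + γ μ))) p.2.2 q.2.2 := by
  obtain ⟨x, a, α⟩ := p
  obtain ⟨y, b, β⟩ := q
  simp only [bondWilsonDiracG, Matrix.of_apply, Matrix.sub_apply, Matrix.smul_apply,
    Matrix.sum_apply, Matrix.add_apply, smul_eq_mul]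
  congr 1
  · by_cases h : x = y ∧ a = b
    · obtain ⟨rfl, rfl⟩ := h
      simp [Matrix.one_apply]
    · rw [if_neg h, if_neg (fun h' => h ⟨(Prod.mk.inj h').1, (Prod.mk.inj (Prod.mk.inj h').2).1⟩),
        zero_mul]
  · congr 1
    refine Finset.sum_congr rfl fun μ _ => ?_
    congr 1
    · split_ifs <;> ring
    · split_ifs <;> ring

/-- **Conjugating `bondWilsonDiracG` by a spinor lift changes the spin matrices**: if
`u γ_μ = γ'_μ u` then `𝒰 D^γ_E = D^{γ'}_E 𝒰`. -/
theorem spinorLift_mul_bondWilsonDiracG [NeZero L] {γ γ' : Fin 4 → Matrix (Fin 4) (Fin 4) ℂ}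
    {u : Matrix (Fin 4) (Fin 4) ℂ} (hγ : ∀ μ, u * γ μ = γ' μ * u) (E : Finset (Edge 4 L))
    (U : GaugeConfig 4 L G) (m r : ℝ) :
    spinorLift (L := L) (N := N) u * bondWilsonDiracG ρ γ E U m r =
      bondWilsonDiracG ρ γ' E U m r * spinorLift (L := L) (N := N) u := by
  ext p q
  rw [spinorLift_mul_apply, mul_spinorLift_apply]
  simp_rw [bondWilsonDiracG_apply_kernel]
  have := congrFun (congrFun (bondKernel_conj ρ hγ E U m r p.1 p.2.1 q.1 q.2.1) p.2.2) q.2.2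
  simpa only [Matrix.mul_apply] using this

/-- **The diluted determinant is basis independent**:
`det (bondWilsonDiracG ρ chiralGamma E U m r) = det (bondWilsonDirac ρ E U m r)`. -/
theorem det_bondWilsonDiracG_chiral [NeZero L] (E : Finset (Edge 4 L)) (U : GaugeConfig 4 L G)
    (m r : ℝ) : (bondWilsonDiracG ρ chiralGamma E U m r).det = (bondWilsonDirac ρ E U m r).det := by
  have h1 : spinorLift (L := L) (N := N) uSpin * spinorLift uInv = 1 := by
    rw [spinorLift_mul_spinorLift, uSpin_mul_uInv]
    simp [spinorLift]
  have key : bondWilsonDiracG ρ chiralGamma E U m r =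
      spinorLift uSpin * bondWilsonDirac ρ E U m r * spinorLift uInv := by
    rw [bondWilsonDirac_eq_bondWilsonDiracG, spinorLift_mul_bondWilsonDiracG ρ uSpin_mul_gamma,
      Matrix.mul_assoc, h1, Matrix.mul_one]
  rw [key, det_mul, det_mul, mul_comm (det _) (det (bondWilsonDirac ρ E U m r)), mul_assoc,
    ← det_mul, h1, det_one, mul_one]

/-! ## Spin tables for the time mirror -/

/-- `ε_α ε_β conj (r + γ'_μ)_{βα}` is `(r + γ'_0)_{αβ}` for `μ = 0` and `(r - γ'_μ)_{αβ}` for spatial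
`μ` (`ε = diag γ'₀`; `γ'₀` commutes with itself and anticommutes with the `γ'_k`). -/
theorem chiral_eps_table_plus (r : ℝ) (μ α β : Fin 4) :
    chiralGamma 0 α α * chiralGamma 0 β β *
        conj (((r : ℂ) • (1 : Matrix (Fin 4) (Fin 4) ℂ) + chiralGamma μ) β α) =
      if μ = 0 then ((r : ℂ) • (1 : Matrix (Fin 4) (Fin 4) ℂ) + chiralGamma μ) α β
      else ((r : ℂ) • (1 : Matrix (Fin 4) (Fin 4) ℂ) - chiralGamma μ) α β := by
  fin_cases μ <;> fin_cases α <;> fin_cases β <;> simp [chiralGamma]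

/-- `ε_α ε_β conj (r - γ'_μ)_{βα}` is `(r - γ'_0)_{αβ}` for `μ = 0` and `(r + γ'_μ)_{αβ}` for spatial
`μ`. -/
theorem chiral_eps_table_minus (r : ℝ) (μ α β : Fin 4) :
    chiralGamma 0 α α * chiralGamma 0 β β *
        conj (((r : ℂ) • (1 : Matrix (Fin 4) (Fin 4) ℂ) - chiralGamma μ) β α) =
      if μ = 0 then ((r : ℂ) • (1 : Matrix (Fin 4) (Fin 4) ℂ) - chiralGamma μ) α β
      else ((r : ℂ) • (1 : Matrix (Fin 4) (Fin 4) ℂ) + chiralGamma μ) α β := by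
  fin_cases μ <;> fin_cases α <;> fin_cases β <;> simp [chiralGamma]

/-! ## The time mirror of the diluted operator -/

/-- Algebra of the entrywise proof: `ε ε' conj (D - ½ Σ f) = ε ε' conj D - ½ Σ ε ε' conj f`. -/
theorem entry_eps_conj_eq (D D' e : ℂ) (f g : Fin 4 → ℂ) (h1 : e * conj D = D')
    (h2 : ∀ μ, e * conj (f μ) = g μ) :
    e * conj (D - (1 / 2 : ℂ) * ∑ μ, f μ) = D' - (1 / 2 : ℂ) * ∑ μ, g μ := by
  rw [← h1, map_sub, map_mul, map_sum, map_div₀, map_one, map_ofNat, mul_sub, Finset.mul_sum,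
    Finset.mul_sum, Finset.mul_sum]
  congr 1
  refine Finset.sum_congr rfl fun μ _ => ?_
  rw [← h2 μ]
  ring

/-- For unitary-valued `ρ`: `conj ρ(g⁻¹)_{ba} = ρ(g)_{ab}`. -/
theorem conj_rep_inv_apply (hρ : ∀ g, ρ g ∈ Matrix.unitaryGroup (Fin N) ℂ) (g : G) (a b : Fin N) :
    conj (ρ g⁻¹ b a) = ρ g a b := by
  have := unitaryRep_star_inv_apply ρ hρ g a b
  rwa [Complex.star_def] at this

/-- For unitary-valued `ρ`: `conj ρ(g)_{ba} = ρ(g⁻¹)_{ab}`. -/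
theorem conj_rep_apply (hρ : ∀ g, ρ g ∈ Matrix.unitaryGroup (Fin N) ℂ) (g : G) (a b : Fin N) :
    conj (ρ g b a) = ρ g⁻¹ a b := by
  have := unitaryRep_star_apply ρ hρ g a b
  rwa [Complex.star_def] at this

/-- **The time mirror of the diluted Wilson–Dirac matrix** (chiral basis, unitary `ρ`). Let `θ` be an
involution of the sites reversing the time shift and commuting with the spatial ones, `V` the
reflected field of `U` (`V(x,0) = U(θ(x+ê₀),0)⁻¹`, `V(x,k) = U(θx,k)`) and `E'` the reflected bond
set of `E` (`(x,0) ∈ E' ↔ (θ(x+ê₀),0) ∈ E`, `(x,k) ∈ E' ↔ (θx,k) ∈ E`). Then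
`D'_{E'}[V]_{p,q} = ε_{α_p} ε_{α_q} conj D'_E[U]_{θ̂q, θ̂p}`, `ε = diag γ'₀`, `θ̂(x,a,α) = (θx,a,α)`. -/
theorem bondWilsonDiracG_chiral_timeReflect (hρ : ∀ g, ρ g ∈ Matrix.unitaryGroup (Fin N) ℂ)
    (θ : TorusSite 4 L → TorusSite 4 L) (hθ : Function.Involutive θ)
    (hθ0 : ∀ x y : TorusSite 4 L, θ x = Site.shift (θ y) 0 ↔ y = Site.shift x 0)
    (hθk : ∀ (x : TorusSite 4 L) (k : Fin 4), k ≠ 0 → θ (Site.shift x k) = Site.shift (θ x) k)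
    {E E' : Finset (Edge 4 L)}
    (hE0 : ∀ x y : TorusSite 4 L, y = Site.shift x 0 →
      ((x, (0 : Fin 4)) ∈ E' ↔ (θ y, (0 : Fin 4)) ∈ E))
    (hEk : ∀ (x : TorusSite 4 L) (k : Fin 4), k ≠ 0 → ((x, k) ∈ E' ↔ (θ x, k) ∈ E))
    (U V : GaugeConfig 4 L G) (hV0 : ∀ x : TorusSite 4 L, V (x, 0) = (U (θ (Site.shift x 0), 0))⁻¹)
    (hVk : ∀ (x : TorusSite 4 L) (k : Fin 4), k ≠ 0 → V (x, k) = U (θ x, k)) (m r : ℝ)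
    (p q : TorusSite 4 L × Fin N × Fin 4) :
    bondWilsonDiracG ρ chiralGamma E' V m r p q =
      chiralGamma 0 p.2.2 p.2.2 * chiralGamma 0 q.2.2 q.2.2 *
        conj (bondWilsonDiracG ρ chiralGamma E U m r (θ q.1, q.2.1, q.2.2) (θ p.1, p.2.1, p.2.2)) := by
  obtain ⟨x, a, α⟩ := p
  obtain ⟨y, b, β⟩ := q
  simp only [bondWilsonDiracG, Matrix.of_apply]
  symm
  refine entry_eps_conj_eq _ _ _ _ _ ?_ (fun μ => ?_)
  · -- diagonal
    by_cases h : ((x, a, α) : TorusSite 4 L × Fin N × Fin 4) = (y, b, β)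
    · simp only [Prod.mk.injEq] at h
      obtain ⟨rfl, rfl, rfl⟩ := h
      rw [if_pos rfl, if_pos rfl, Complex.conj_ofReal]
      have : chiralGamma 0 α α * chiralGamma 0 α α = 1 := by fin_cases α <;> simp [chiralGamma]
      rw [this, one_mul]
    · have h' : ¬ ((θ y, b, β) : TorusSite 4 L × Fin N × Fin 4) = (θ x, a, α) := by
        intro h'
        simp only [Prod.mk.injEq, hθ.injective.eq_iff] at h'
        exact h (by rw [h'.1, h'.2.1, h'.2.2])
      rw [if_neg h', if_neg h, map_zero, mul_zero]
  · -- the hopping terms in direction `μ`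
    rw [map_add, mul_add]
    by_cases hμ : μ = 0
    · subst hμ
      congr 1
      · -- forward temporal ↔ conj (forward temporal at the mirrored indices)
        simp only [hθ0 x y]
        by_cases h : y = Site.shift x 0
        · by_cases hm : (x, (0 : Fin 4)) ∈ E'
          · rw [if_pos ⟨h, (hE0 x y h).1 hm⟩, if_pos ⟨h, hm⟩, map_mul, ← mul_assoc,
              chiral_eps_table_minus, if_pos rfl, conj_rep_apply ρ hρ, hV0, ← h]
          · rw [if_neg (fun h' => hm ((hE0 x y h).2 h'.2)), if_neg (fun h' => hm h'.2), map_zero,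
              mul_zero]
        · rw [if_neg (fun h' => h h'.1), if_neg (fun h' => h h'.1), map_zero, mul_zero]
      · -- backward temporal ↔ conj (backward temporal)
        simp only [hθ0 y x]
        by_cases h : x = Site.shift y 0
        · by_cases hm : (y, (0 : Fin 4)) ∈ E'
          · rw [if_pos ⟨h, (hE0 y x h).1 hm⟩, if_pos ⟨h, hm⟩, map_mul, ← mul_assoc,
              chiral_eps_table_plus, if_pos rfl, conj_rep_inv_apply ρ hρ, hV0, inv_inv, ← h]
          · rw [if_neg (fun h' => hm ((hE0 y x h).2 h'.2)), if_neg (fun h' => hm h'.2), map_zero,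
              mul_zero]
        · rw [if_neg (fun h' => h h'.1), if_neg (fun h' => h h'.1), map_zero, mul_zero]
    · -- spatial `μ`: forward ↔ conj backward, backward ↔ conj forward
      rw [add_comm (chiralGamma 0 α α * chiralGamma 0 β β * conj _)]
      have h1 : θ y = Site.shift (θ x) μ ↔ y = Site.shift x μ := by
        rw [← hθk x μ hμ, hθ.injective.eq_iff]
      have h2 : θ x = Site.shift (θ y) μ ↔ x = Site.shift y μ := by
        rw [← hθk y μ hμ, hθ.injective.eq_iff]
      simp only [h1, h2]
      congr 1
      · by_cases h : y = Site.shift x μ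
        · by_cases hm : (x, μ) ∈ E'
          · rw [if_pos ⟨h, (hEk x μ hμ).1 hm⟩, if_pos ⟨h, hm⟩, map_mul, ← mul_assoc,
              chiral_eps_table_plus, if_neg hμ, conj_rep_inv_apply ρ hρ, hVk x μ hμ]
          · rw [if_neg (fun h' => hm ((hEk x μ hμ).2 h'.2)), if_neg (fun h' => hm h'.2), map_zero,
              mul_zero]
        · rw [if_neg (fun h' => h h'.1), if_neg (fun h' => h h'.1), map_zero, mul_zero]
      · by_cases h : x = Site.shift y μ
        · by_cases hm : (y, μ) ∈ E'
          · rw [if_pos ⟨h, (hEk y μ hμ).1 hm⟩, if_pos ⟨h, hm⟩, map_mul, ← mul_assoc,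
              chiral_eps_table_minus, if_neg hμ, conj_rep_apply ρ hρ, hVk y μ hμ]
          · rw [if_neg (fun h' => hm ((hEk y μ hμ).2 h'.2)), if_neg (fun h' => hm h'.2), map_zero,
              mul_zero]
        · rw [if_neg (fun h' => h h'.1), if_neg (fun h' => h h'.1), map_zero, mul_zero]

end Summit.QuantumFields.QCD.Theorems.UnquenchedChessboardBoundLine

end
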